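import Summits.QuantumFields.BalabanUV.Beta.FP.TowerLawFullIndexG
import Summits.QuantumFields.BalabanUV.Beta.FP.KernelPeriodisationFibHessKerTower

/-!
# `BalabanUV.Beta.FP.TowerKernelLawG` — road «FP» for binder row D1, ROUTE T under RULING R-D1-g52-1 (β1) ∕ R-FP-69 ∕ R-FP-70: **THE `-G` EDITION OF #42a
# `TowerKernelLaw`** — THE TOWER's ONE-LOOP KERNEL LAW ON THE LATTICE, GENERIC over leaf-06 G-0's step-row family `Q : StepRows d Lc`, the form-kernel family
# `K : ℕ → (Fin (d+1) → ℕ) → MKer (d+1) (Fib d)` AND the top comb's lattice chart kernel `A_G`: #41d-G `TowerLawFullIndexG.hessT_fullIndex_law_tower_G` AT EVERY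
# BOX `M′ B` of a growing `Lc`-divisible box sequence, COMPOSED BY ONE TERM with leaf-06's (P2‴)-on-the-tower `KernelPeriodisationFibHessKerTower` §2
# `hessKer_law_of_tower_hessT_law` (the G chart ABSTRACT — #42a used §3 `_coDress`, which pins `A_G` to the ROOTED co-dressed resolvent and discharges its
# decay ∕ blocking covariance by an2's lemmas; here those two letters are DISPLAYED like the one-shot charts'):
# `hessKer A_N 𝒱_N 𝒲_N μ ν z = hessKer A_F 𝒱_F 𝒲_F μ ν z + hessKer A_G 𝒱_G 𝒲_G μ ν z` on `ℤ^(d+1)` — one instance per tower depth `n` of the hypothesis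
# `hlaw` of #42b `StepRecursionFeedNested.stepRecursion_of_hessKer_laws_nested` (the ladder `j ≥ 1`, depth `n` serving storey `j = n + 1`), modulo the
# (C1) namings and the identifications (L2′); under (β1) the storeys' systems are the (0.4)-symmetrised tower's (`Q := QSym Lc`, `K ℓ _ := bhKStepSh d Lc
# (Dsh Lc) ℓ`, `rs := fun _ => ctrOff (d+1) Lc`), under the rooted reading #42a's (`Q := Qstep`, `K := bhKStepAt`, `A_G := coDressKBmAt (toSite (rs 0)) Lc
# (KInvStep Lc (lev 0))` with an2's `decays_coDressKBmAt_KInvStep ∕ shiftK_coDressKBmAt_KInvStep` — #42a `hessKer_law_tower` IS that instance).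

WHAT IS DISPLAYED.  (i) #41d-G's binders AT EVERY BOX `B : ℕ` (its generic pins `H₀ Q₁₀ τ₁ τ₂ W₀ P Dbar Γ I L S 𝔔₀` over `(Q, K)`, the top rows `Q₂₀ B`
with `htop B`, `hH₀t B`, its direction module `V B` with `hv lv Xbf`, its jets ∕ namings ∕ generator jets as functions of the direction, #21's rows `uTop
hH₁t hH₂t a1 a2 c1 c2 d1 d2 ∀ v` and `a0 d0`, the three right inverses `XN XF XG` with their LEGS over the chart kernels `A_N A_F A_G` under the torus rules,
the packing injections `fN fF fG`) — the box-free data shared: `Lc lev rs n c Q K`, leaf-05's one-step letters `hone hId` (v1.1, R-FP-71: #41d-G v1.1's box-dependent single-instance rows `hSL c0 hTW` are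
box-indexed like the other `M′`-rows; v1's box-free universal covariance family `hc0` is gone — leaf-02 g31 W-1 l.56632),
the blockings `ρ_X L_X`, the lattice chart kernels `A_N A_F A_G`; (ii) (P2‴)'s lattice letters: the box sequence grows (`hM′gr`) and is `Lc`-divisible
(`hM′`), `A_N ∕ A_F ∕ A_G` decay and are blocking-`Lc^(n+2) ∕ Lc^(n+1) ∕ Lc` covariant, the nine lattice base-point jets are bi-localised; (iii) THE (C1)
NAMINGS AS HYPOTHESES, PER BOX: the periodised lattice jets `perF (T B) (dper (T B) (𝒱_X …))` carry #39's parities and their field ∕ multiplier blocks ARE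
the door's jets in two direction labels `a₁ a₂` of a box-free label type `σ` read through `dv B : σ → V B` (G's H-blocks carrying `∏_{i<n+1} wVH d Lc
(lev i)`).  NOTHING is named here (an2's F6d `JcComp` ∕ `CompositeOneShotJets` and leaf-02's sym junctions bind them at the record).
CONCLUSION: `hessKer AN 𝒱N 𝒲N μ ν z = hessKer AF 𝒱F 𝒲F μ ν z + hessKer AG 𝒱G 𝒲G μ ν z`.
PROOF: ONE term — leaf-06 §2 at `hlaw B :=` #41d-G at box `M′ B` with the (S3-2) torus jets SUBSTITUTED by the periodised lattice jets.  [folklore]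
composition BY NAME; no `def`, no `def … : Prop`, nothing cited, 0 sorry; generated from #41d-G's bytes by `HOME/b2b-balaban-beta-d1-p3/g30/…/gen42aG.py`
(= g28's `gen42a.py` with the box index renamed `B` — `K` is the form-kernel family —, the G system displayed, leaf-06 §2 for §3).  The rows, the three
legs, the decay ∕ bi-localisation letters, the brick inputs and the namings are HYPOTHESES (nothing of the dictionary ∕ Bałaban's asserted; the presentation is
the ROW's (β1) ruling).  NOT HERE: the identifications (L2′), the (C1) namings (`TowerKernelLawNamed`, design (A) of R-FP-68), the END (#42b §3).

HONEST DEPENDENCY (page 1, mandatory): continuum YM on T⁴ ⇐ BetaPertH ∧ nine spine estimates (0/9 proved); BetaPertH ⇐ (D1) ∧ (D4) ∧ CAP+tail;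
G-an2-4 gates asym, D1 and NE2/3/4.  HONEST FRAMING (cell contract, verbatim): «discharging `BetaPertH` makes Bałaban's UV stability UNCONDITIONAL —
a real constructive-QFT result; it is NOT the continuum limit and NOT the Clay problem.»  ABSOLUTE RULE (cell charter, verbatim): «No internally-minted
statement may enter as a cited fact. Every hypothesis is either kernel-proved in this package or a verbatim quotation of a PUBLISHED theorem with page
reference. The manuscript(s) under audit are NOT citable for their own disputed steps — they are the thing under adjudication; programme-internal
(2001/route/tribunal) claims are never citable.»  0 estimates; 0∕4 row-D1 binders (hW, hR, D1Tel, D1Rep — `D1Tel` CONCLUDED only from displayed rows);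
NOT (C1), NOT (L2′), NOT (T-ID) complete, NOT SDF, NOT D1, NOT BetaPertH, NOT continuum, NOT Clay.  Road «FP» OWNER, b2b-balaban-beta-d1-p3 gen 30 (v1) ∕ gen 31 (v1.1, R-FP-71),
2026-08-24.  No existing file touched.
-/

noncomputable section

open scoped BigOperators Matrix

namespace Summit.QuantumFields.BalabanUV.Beta.FP.TowerKernelLawG

open Matrix Finset Filter
open Literature.Probability.LatticeModels (Torus.proj)
open Literature.MathematicalPhysics.QuantumFieldTheory.Balaban1983to89
open Literature.MathematicalPhysics.QuantumFieldTheory.Balaban1983to89.Beta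
open Literature.MathematicalPhysics.QuantumFieldTheory.Balaban1983to89.Beta.Composition (kkt)
open Literature.MathematicalPhysics.QuantumFieldTheory.Balaban1983to89.Beta.CompositionSingular (effForm flucCov minOp minOpL)
open B5Prop11Plancherel (fine)
open B6Lemma24Torus (pbox mem_pbox)
open AffineAveraging (Site box toSite unitVec)
open OneStepResolventKernel (Fib)
open OneStepKernelFamily (KInvStep)
open ExpKernelCalculus (MKer Decays BiLoc shiftK hessKer)
open BalabanStepJetsSucc (wVH)
open Summit.QuantumFields.BalabanUV.Beta.AxialDressingRooted (axEc coDressKBmAt)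
open Summit.QuantumFields.BalabanUV.Beta.BorderedHessian (bhKStepAt stepScale)
open Summit.QuantumFields.BalabanUV.Beta.D1BFx.LogDetSecondVariation (secondVar)
open Summit.QuantumFields.BalabanUV.Beta.D1BFx.MixedVarPackedHess (hessT)
open Summit.QuantumFields.BalabanUV.Beta.FP.KernelPeriodisationFib (Idx perF)
open Summit.QuantumFields.BalabanUV.Beta.FP.KernelPeriodisationFibLoc (dper)
open Summit.QuantumFields.BalabanUV.Beta.FP.TorusCombRows (Res combRowsT)
open Summit.QuantumFields.BalabanUV.Beta.FP.TorusCompositeObjects (towerTorus compRows NParam combF bigP towerGen)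
open Summit.QuantumFields.BalabanUV.Beta.FP.TorusCompositeObjectsG (StepRows compRowsG nestedSliceG)
open Summit.QuantumFields.BalabanUV.Beta.FP.TorusCompositeFP (evalN)
open Summit.QuantumFields.BalabanUV.Beta.FP.TorusGaugeCovariance (tgrad)
open Summit.QuantumFields.BalabanUV.Beta.GAN24.FineReadoutCauchyFrame (toSite_mem_range)
open Summit.QuantumFields.BalabanUV.Beta.FP.TowerLawFullIndexG (hessT_fullIndex_law_tower_G)
open Summit.QuantumFields.BalabanUV.Beta.FP.KernelPeriodisationFibHessKerTower (hessKer_law_of_tower_hessT_law)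

variable {d : ℕ}

section LawG

variable (Lc : ℕ) [NeZero Lc] (M' : ℕ → (Fin (d + 1) → ℕ)) [∀ B μ, NeZero (M' B μ)] (lev : ℕ → ℕ) (rs : ℕ → (Fin (d + 1) → ℕ)) (n : ℕ)

set_option synthInstance.maxSize 1024 in
/-- [folklore] **THE TOWER's ONE-LOOP KERNEL LAW ON THE LATTICE, GENERIC OVER `(Q, K, A_G)`** (the `-G` edition of #42a `hessKer_law_tower`, R-FP-70;
one instance per tower depth `n`).  A growing (`hM′gr`) `Lc`-divisible (`hM′`) box sequence `M′ B`; #41d-G `hessT_fullIndex_law_tower_G`'s binders AT EVERY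
BOX `B` (box-free data shared, incl. `Q K hone hId c`), its (S3-2) torus jets SUBSTITUTED by the periodisations `perF (T B) (dper (T B) (𝒱_X …))` of
nine lattice base-point jets (the (C1) namings as hypotheses: parities + the door's jets on the blocks, per box); (P2‴)'s lattice letters (decay +
blocking covariance of `A_N A_F A_G`, bi-localisation of the jets) ⊢ `hessKer AN 𝒱N 𝒲N μ ν z = hessKer AF 𝒱F 𝒲F μ ν z + hessKer AG 𝒱G 𝒲G μ ν z`.
Proof: ONE term of leaf-06 §2 `hessKer_law_of_tower_hessT_law` at `hlaw B :=` #41d-G at box `M′ B`. -/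
theorem hessKer_law_tower_G (Q : StepRows d Lc) (K : ℕ → (Fin (d + 1) → ℕ) → MKer (d + 1) (Fib d)) (hM'gr : ∀ N : ℕ, ∀ᶠ B in atTop, ∀ i, N ≤ M' B i) (hrs : ∀ k, rs k ∈ box (d + 1) Lc) (hlev : ∀ i, lev i = lev (i + 1) + 1)
    -- (P2‴)'s lattice base-point jets of the three systems (fibre `Fib d`), and the base points
    (𝒱N 𝒱F 𝒱G : Fin (d + 1) → (Fin (d + 1) → ℤ) → MKer (d + 1) (Fib d))
    (𝒲N 𝒲F 𝒲G : Fin (d + 1) → (Fin (d + 1) → ℤ) → Fin (d + 1) → (Fin (d + 1) → ℤ) → MKer (d + 1) (Fib d))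
    (μ ν : Fin (d + 1)) (z : Fin (d + 1) → ℤ)
    -- #41d-G's binders AT EVERY BOX `B` (generated from its bytes; `X ↦ X B` for every box-dependent binder `X`, `M′ ↦ M′ B`; `Q K hone hId c` box-free; `hSL c0 hTW` box-indexed, R-FP-71)
    (hM' : ∀ B : ℕ, ∀ i, Lc ∣ (M' B) i)
    -- the top multipliers' slot presentation (#21 VERBATIM)
    {κ : ℕ → Type*}
    [∀ B : ℕ, Fintype (κ B)]
    [∀ B : ℕ, DecidableEq (κ B)]
    -- the composite objects PINNED over the abstract families: finest form `K (lev (n+1)) (rs (n+1))`, rows `compRowsG Lc Q`, nested slice `nestedSliceG Lc Q`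
    {H₀ : ∀ B : ℕ, Matrix (↥(pbox (towerTorus Lc (M' B) (n + 1))) × Fin (d + 1)) (↥(pbox (towerTorus Lc (M' B) (n + 1))) × Fin (d + 1)) ℝ}
    {Q₁₀ : ∀ B : ℕ, Matrix (↥(pbox (M' B)) × Fin (d + 1)) (↥(pbox (towerTorus Lc (M' B) (n + 1))) × Fin (d + 1)) ℝ}
    {τ₁ : ∀ B : ℕ, Matrix (NParam Lc (fine Lc (M' B)) (fun k => rs (k + 1)) n) (↥(pbox (towerTorus Lc (M' B) (n + 1))) × Fin (d + 1)) ℝ}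
    (hH₀ : ∀ B : ℕ, (H₀ B) = (perF (towerTorus Lc (M' B) (n + 1)) (K (lev (n + 1)) (rs (n + 1)))).submatrix
        (fun b : (↥(pbox (towerTorus Lc (M' B) (n + 1))) × Fin (d + 1)) => ((b.1, Sum.inl b.2) : Idx (towerTorus Lc (M' B) (n + 1)) (Fib d)))
        (fun b : (↥(pbox (towerTorus Lc (M' B) (n + 1))) × Fin (d + 1)) => ((b.1, Sum.inl b.2) : Idx (towerTorus Lc (M' B) (n + 1)) (Fib d))))
    (hQ₁₀ : ∀ B : ℕ, (Q₁₀ B) = compRowsG Lc Q (M' B) lev rs (n + 1))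
    (hτ₁ : ∀ B : ℕ, (τ₁ B) = bigP Lc (fine Lc (M' B)) (fun k => rs (k + 1)) (fun k => toSite_mem_range (hrs (k + 1))) n)
    -- DISPLAYED BRICK INPUTS (discharged per instance): the finest form block is symmetric; leaf-05's one-step letters (h1)ₖ ∕ (hId)ₖ at every storey
    (hH₀t : ∀ B : ℕ, (H₀ B)ᵀ = (H₀ B))
    (hone : ∀ (k : ℕ) (T : Fin (d + 1) → ℕ) [∀ μ, NeZero (T μ)],
      (kkt ((perF (fine Lc T) (K (lev k) (rs k))).submatrix
            (fun b : ↥(pbox (fine Lc T)) × Fin (d + 1) => ((b.1, Sum.inl b.2) : Idx (fine Lc T) (Fib d)))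
            (fun b : ↥(pbox (fine Lc T)) × Fin (d + 1) => ((b.1, Sum.inl b.2) : Idx (fine Lc T) (Fib d))))
        (fromRows (Q T (lev k) (rs k)) (combF Lc (fine Lc T) (rs k)))).det ≠ 0)
    (hId : ∀ (k : ℕ) (T : Fin (d + 1) → ℕ) [∀ μ, NeZero (T μ)] (r' : Fin (d + 1) → ℕ),
      (effForm ((perF (fine Lc T) (K (lev k) (rs k))).submatrix
            (fun b : ↥(pbox (fine Lc T)) × Fin (d + 1) => ((b.1, Sum.inl b.2) : Idx (fine Lc T) (Fib d)))
            (fun b : ↥(pbox (fine Lc T)) × Fin (d + 1) => ((b.1, Sum.inl b.2) : Idx (fine Lc T) (Fib d))))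
          (fromRows (Q T (lev k) (rs k)) (combF Lc (fine Lc T) (rs k)))).toBlocks₁₁
        = (wVH d Lc (lev k + 1))⁻¹ • (perF T (K (lev k + 1) r')).submatrix
            (fun b : ↥(pbox T) × Fin (d + 1) => ((b.1, Sum.inl b.2) : Idx T (Fib d)))
            (fun b : ↥(pbox T) × Fin (d + 1) => ((b.1, Sum.inl b.2) : Idx T (Fib d))))
    -- (SLICE-m) OF THE TOWER BELOW `M′`, DISPLAYED (R-FP-71 «display what you use»): its NESTED comb slice is transversal to its generators
    -- (rooted: leaf-06 `TorusCompositeSlice.det_nestedSlice_mul_towerGen_ne_zero`; sym: leaf-06's G-1 sym theorem at the constant root list, fed leaf-02's R-20)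
    (hSL : ∀ B : ℕ, (nestedSliceG Lc Q (fine Lc (M' B)) (fun k => lev (k + 1)) (fun k => rs (k + 1)) n
        * towerGen Lc (fine Lc (M' B)) (fun k => rs (k + 1)) n).det ≠ 0)
    {τ₂ : ∀ B : ℕ, Matrix (Res (toSite (rs 0)) Lc (M' B)) (↥(pbox (M' B)) × Fin (d + 1)) ℝ}
    (hτ₂ : ∀ B : ℕ, (τ₂ B) = combF Lc (M' B) (rs 0))
    (Q₂₀ : ∀ B : ℕ, Matrix (κ B) (↥(pbox (M' B)) × Fin (d + 1)) ℝ)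
    (htop : ∀ B : ℕ, (kkt ((perF (M' B) (K (lev 0) (rs 0))).submatrix (fun b : ↥(pbox (M' B)) × Fin (d + 1) => ((b.1, Sum.inl b.2) : Idx (M' B) (Fib d)))
        (fun b : ↥(pbox (M' B)) × Fin (d + 1) => ((b.1, Sum.inl b.2) : Idx (M' B) (Fib d)))) (fromRows (Q₂₀ B) (τ₂ B))).det ≠ 0)
    {W₀ : ∀ B : ℕ, Matrix (↥(pbox (towerTorus Lc (M' B) (n + 1))) × Fin (d + 1)) (NParam Lc (M' B) rs (n + 1)) ℝ}
    (hW₀ : ∀ B : ℕ, (W₀ B) = towerGen Lc (M' B) rs (n + 1))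
    {P : ∀ B : ℕ, Matrix (NParam Lc (M' B) rs (n + 1)) (↥(pbox (towerTorus Lc (M' B) (n + 1))) × Fin (d + 1)) ℝ}
    (hP : ∀ B : ℕ, (P B) = bigP Lc (M' B) rs (fun k => toSite_mem_range (hrs k)) (n + 1))
    -- the step constant of the chart transport (#21's `c`), the (COV-m) order-0 image PINNED, the one-shot resolvent words and `𝔔₀` NAMED (#21 VERBATIM)
    (c : ℝ)
    {Dbar : ∀ B : ℕ, Matrix (↥(pbox (M' B)) × Fin (d + 1)) (Res (toSite (rs 0)) Lc (M' B)) ℝ}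
    (hDbar : ∀ B : ℕ, (Dbar B) = (∏ i ∈ range (n + 1), (stepScale d Lc (lev (i + 1)) * ((box (d + 1) Lc).card : ℝ))) •
        (tgrad (M' B)).submatrix (fun a : (↥(pbox (M' B)) × Fin (d + 1)) => ((a.1, Sum.inl a.2) : Idx (M' B) (Fib d))) (fun t : (Res (toSite (rs 0)) Lc (M' B)) => (t.1 : ↥(pbox (M' B)))))
    -- (COV-m) ORDER 0 AT THE TOP DEPTH in the pinned letters and the ONE-SHOT slice's transversality, DISPLAYED (R-FP-71 «display what you use»;
    -- rooted: leaf-02 `compRows_mul_towerGen_succ` ∕ leaf-06 `torus_hTW_oneShot_tower`; sym: leaf-02's R-20 at the constant root list ∕ leaf-06 G-2 §2)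
    (c0 : ∀ B : ℕ, (Q₁₀ B) * (W₀ B) = fromCols (Dbar B) (0 : Matrix (↥(pbox (M' B)) × Fin (d + 1)) (NParam Lc (fine Lc (M' B)) (fun k => rs (k + 1)) n) ℝ))
    (hTW : ∀ B : ℕ, (Matrix.fromRows ((τ₂ B) * (Q₁₀ B)) (τ₁ B) * (W₀ B)).det ≠ 0)
    {Γ : ∀ B : ℕ, Matrix (↥(pbox (towerTorus Lc (M' B) (n + 1))) × Fin (d + 1)) (↥(pbox (towerTorus Lc (M' B) (n + 1))) × Fin (d + 1)) ℝ}
    {I : ∀ B : ℕ, Matrix (↥(pbox (towerTorus Lc (M' B) (n + 1))) × Fin (d + 1)) ((↥(pbox (M' B)) × Fin (d + 1)) ⊕ (NParam Lc (fine Lc (M' B)) (fun k => rs (k + 1)) n)) ℝ}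
    {L : ∀ B : ℕ, Matrix ((↥(pbox (M' B)) × Fin (d + 1)) ⊕ (NParam Lc (fine Lc (M' B)) (fun k => rs (k + 1)) n)) (↥(pbox (towerTorus Lc (M' B) (n + 1))) × Fin (d + 1)) ℝ}
    {S : ∀ B : ℕ, Matrix ((↥(pbox (M' B)) × Fin (d + 1)) ⊕ (NParam Lc (fine Lc (M' B)) (fun k => rs (k + 1)) n)) ((↥(pbox (M' B)) × Fin (d + 1)) ⊕ (NParam Lc (fine Lc (M' B)) (fun k => rs (k + 1)) n)) ℝ}
    (hΓ : ∀ B : ℕ, flucCov (H₀ B) (fromRows (Q₁₀ B) (τ₁ B)) = (Γ B))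
    (hI : ∀ B : ℕ, minOp (H₀ B) (fromRows (Q₁₀ B) (τ₁ B)) = (I B))
    (hL : ∀ B : ℕ, minOpL (H₀ B) (fromRows (Q₁₀ B) (τ₁ B)) = (L B))
    (hS : ∀ B : ℕ, effForm (H₀ B) (fromRows (Q₁₀ B) (τ₁ B)) = (S B))
    {𝔔₀ : ∀ B : ℕ, Matrix (κ B) (↥(pbox (towerTorus Lc (M' B) (n + 1))) × Fin (d + 1)) ℝ}
    (h𝔔₀ : ∀ B : ℕ, (Q₂₀ B) * (Q₁₀ B) = (𝔔₀ B))
    -- the direction module and its DISPLAYED read-outs: finest-level direction `h := hv v` (enters only the rows and the generator jets — no linearity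
    -- needed here: the jets' (bi)linearity is displayed; at the record it follows from `hv`'s), tree-gauge parameter `λ := lv v` and top generator
    -- `X̄ := Xbf v` (LINEAR: they enter the one-shot namings `k1 k2 q1 q2`)
    {V : ℕ → Type*}
    [∀ B : ℕ, AddCommGroup (V B)]
    [∀ B : ℕ, Module ℝ (V B)]
    (hv : ∀ B : ℕ, (V B) → ((↥(pbox (towerTorus Lc (M' B) (n + 1))) × Fin (d + 1)) → ℝ))
    (lv : ∀ B : ℕ, (V B) → (↥(pbox (towerTorus Lc (M' B) (n + 1))) → ℝ))
    (hlv : ∀ B : ℕ, ∀ (r : ℝ) (x y : (V B)), (lv B) (r • x + y) = r • (lv B) x + (lv B) y)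
    (Xbf : ∀ B : ℕ, (V B) → Matrix (κ B) (κ B) ℝ)
    (hXbf : ∀ B : ℕ, ∀ (r : ℝ) (x y : (V B)), (Xbf B) (r • x + y) = r • (Xbf B) x + (Xbf B) y)
    -- #21's displayed jets AS FUNCTIONS of the direction: first order linear, second order in two slots (linear in each; the door reads the diagonal)
    (H₁f : ∀ B : ℕ, (V B) → Matrix (↥(pbox (towerTorus Lc (M' B) (n + 1))) × Fin (d + 1)) (↥(pbox (towerTorus Lc (M' B) (n + 1))) × Fin (d + 1)) ℝ)
    (hH₁l : ∀ B : ℕ, ∀ (r : ℝ) (x y : (V B)), (H₁f B) (r • x + y) = r • (H₁f B) x + (H₁f B) y)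
    (Q₁₁f : ∀ B : ℕ, (V B) → Matrix (↥(pbox (M' B)) × Fin (d + 1)) (↥(pbox (towerTorus Lc (M' B) (n + 1))) × Fin (d + 1)) ℝ)
    (hQ₁₁l : ∀ B : ℕ, ∀ (r : ℝ) (x y : (V B)), (Q₁₁f B) (r • x + y) = r • (Q₁₁f B) x + (Q₁₁f B) y)
    (Q₂₁f : ∀ B : ℕ, (V B) → Matrix (κ B) (↥(pbox (M' B)) × Fin (d + 1)) ℝ)
    (hQ₂₁l : ∀ B : ℕ, ∀ (r : ℝ) (x y : (V B)), (Q₂₁f B) (r • x + y) = r • (Q₂₁f B) x + (Q₂₁f B) y)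
    (H₂f : ∀ B : ℕ, (V B) → (V B) → Matrix (↥(pbox (towerTorus Lc (M' B) (n + 1))) × Fin (d + 1)) (↥(pbox (towerTorus Lc (M' B) (n + 1))) × Fin (d + 1)) ℝ)
    (hH₂l : ∀ B : ℕ, ∀ (r : ℝ) (x y z : (V B)), (H₂f B) (r • x + y) z = r • (H₂f B) x z + (H₂f B) y z)
    (hH₂r : ∀ B : ℕ, ∀ (r : ℝ) (x y z : (V B)), (H₂f B) z (r • x + y) = r • (H₂f B) z x + (H₂f B) z y)
    (Q₁₂f : ∀ B : ℕ, (V B) → (V B) → Matrix (↥(pbox (M' B)) × Fin (d + 1)) (↥(pbox (towerTorus Lc (M' B) (n + 1))) × Fin (d + 1)) ℝ)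
    (hQ₁₂l : ∀ B : ℕ, ∀ (r : ℝ) (x y z : (V B)), (Q₁₂f B) (r • x + y) z = r • (Q₁₂f B) x z + (Q₁₂f B) y z)
    (hQ₁₂r : ∀ B : ℕ, ∀ (r : ℝ) (x y z : (V B)), (Q₁₂f B) z (r • x + y) = r • (Q₁₂f B) z x + (Q₁₂f B) z y)
    (Q₂₂f : ∀ B : ℕ, (V B) → (V B) → Matrix (κ B) (↥(pbox (M' B)) × Fin (d + 1)) ℝ)
    (hQ₂₂l : ∀ B : ℕ, ∀ (r : ℝ) (x y z : (V B)), (Q₂₂f B) (r • x + y) z = r • (Q₂₂f B) x z + (Q₂₂f B) y z)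
    (hQ₂₂r : ∀ B : ℕ, ∀ (r : ℝ) (x y z : (V B)), (Q₂₂f B) z (r • x + y) = r • (Q₂₂f B) z x + (Q₂₂f B) z y)
    -- #21's composite and one-shot NAMINGS as functions (`h𝔔₁ h𝔔₂ k1 k2 q1 q2`; `X := −(c • diagonal (λ ∘ pr))` at `λ := lv v`; order 2 in two slots)
    (𝔔₁f : ∀ B : ℕ, (V B) → Matrix (κ B) (↥(pbox (towerTorus Lc (M' B) (n + 1))) × Fin (d + 1)) ℝ)
    (h𝔔₁ : ∀ B : ℕ, ∀ v, (Q₂₁f B) v * (Q₁₀ B) + (Q₂₀ B) * (Q₁₁f B) v = (𝔔₁f B) v)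
    (𝔔₂f : ∀ B : ℕ, (V B) → (V B) → Matrix (κ B) (↥(pbox (towerTorus Lc (M' B) (n + 1))) × Fin (d + 1)) ℝ)
    (h𝔔₂ : ∀ B : ℕ, ∀ v v', (Q₂₂f B) v v' * (Q₁₀ B) + (Q₂₁f B) v * (Q₁₁f B) v' + ((Q₂₁f B) v * (Q₁₁f B) v' + (Q₂₀ B) * (Q₁₂f B) v v') = (𝔔₂f B) v v')
    (H'₁f : ∀ B : ℕ, (V B) → Matrix (↥(pbox (towerTorus Lc (M' B) (n + 1))) × Fin (d + 1)) (↥(pbox (towerTorus Lc (M' B) (n + 1))) × Fin (d + 1)) ℝ)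
    (hH'₁f : ∀ B : ℕ, ∀ v, (H'₁f B) v = -((-(c • Matrix.diagonal (fun b : (↥(pbox (towerTorus Lc (M' B) (n + 1))) × Fin (d + 1)) => (lv B) v b.1)))ᵀ * (H₀ B)) + (H₁f B) v + (H₀ B) * (-(c • Matrix.diagonal (fun b : (↥(pbox (towerTorus Lc (M' B) (n + 1))) × Fin (d + 1)) => (lv B) v b.1))))
    (H'₂f : ∀ B : ℕ, (V B) → (V B) → Matrix (↥(pbox (towerTorus Lc (M' B) (n + 1))) × Fin (d + 1)) (↥(pbox (towerTorus Lc (M' B) (n + 1))) × Fin (d + 1)) ℝ)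
    (hH'₂f : ∀ B : ℕ, ∀ v v', (H'₂f B) v v' = ((-(c • Matrix.diagonal (fun b : (↥(pbox (towerTorus Lc (M' B) (n + 1))) × Fin (d + 1)) => (lv B) v b.1))) * (-(c • Matrix.diagonal (fun b : (↥(pbox (towerTorus Lc (M' B) (n + 1))) × Fin (d + 1)) => (lv B) v' b.1))))ᵀ * (H₀ B) + (-((-(c • Matrix.diagonal (fun b : (↥(pbox (towerTorus Lc (M' B) (n + 1))) × Fin (d + 1)) => (lv B) v b.1)))ᵀ * (H₁f B) v') + -((-(c • Matrix.diagonal (fun b : (↥(pbox (towerTorus Lc (M' B) (n + 1))) × Fin (d + 1)) => (lv B) v b.1)))ᵀ * (H₀ B) * (-(c • Matrix.diagonal (fun b : (↥(pbox (towerTorus Lc (M' B) (n + 1))) × Fin (d + 1)) => (lv B) v' b.1)))))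
      + ((-((-(c • Matrix.diagonal (fun b : (↥(pbox (towerTorus Lc (M' B) (n + 1))) × Fin (d + 1)) => (lv B) v b.1)))ᵀ * (H₁f B) v') + -((-(c • Matrix.diagonal (fun b : (↥(pbox (towerTorus Lc (M' B) (n + 1))) × Fin (d + 1)) => (lv B) v b.1)))ᵀ * (H₀ B) * (-(c • Matrix.diagonal (fun b : (↥(pbox (towerTorus Lc (M' B) (n + 1))) × Fin (d + 1)) => (lv B) v' b.1))))) + ((H₂f B) v v' + (H₁f B) v * (-(c • Matrix.diagonal (fun b : (↥(pbox (towerTorus Lc (M' B) (n + 1))) × Fin (d + 1)) => (lv B) v' b.1))) + ((H₁f B) v * (-(c • Matrix.diagonal (fun b : (↥(pbox (towerTorus Lc (M' B) (n + 1))) × Fin (d + 1)) => (lv B) v' b.1))) + (H₀ B) * ((-(c • Matrix.diagonal (fun b : (↥(pbox (towerTorus Lc (M' B) (n + 1))) × Fin (d + 1)) => (lv B) v b.1))) * (-(c • Matrix.diagonal (fun b : (↥(pbox (towerTorus Lc (M' B) (n + 1))) × Fin (d + 1)) => (lv B) v' b.1))))))))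
    (𝔔'₁f : ∀ B : ℕ, (V B) → Matrix (κ B) (↥(pbox (towerTorus Lc (M' B) (n + 1))) × Fin (d + 1)) ℝ)
    (h𝔔'₁f : ∀ B : ℕ, ∀ v, (𝔔'₁f B) v = (Xbf B) v * (𝔔₀ B) + (𝔔₁f B) v + (𝔔₀ B) * (-(c • Matrix.diagonal (fun b : (↥(pbox (towerTorus Lc (M' B) (n + 1))) × Fin (d + 1)) => (lv B) v b.1))))
    (𝔔'₂f : ∀ B : ℕ, (V B) → (V B) → Matrix (κ B) (↥(pbox (towerTorus Lc (M' B) (n + 1))) × Fin (d + 1)) ℝ)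
    (h𝔔'₂f : ∀ B : ℕ, ∀ v v', (𝔔'₂f B) v v' = (Xbf B) v * (Xbf B) v' * (𝔔₀ B) + ((Xbf B) v * (𝔔₁f B) v' + (Xbf B) v * (𝔔₀ B) * (-(c • Matrix.diagonal (fun b : (↥(pbox (towerTorus Lc (M' B) (n + 1))) × Fin (d + 1)) => (lv B) v' b.1))))
      + (((Xbf B) v * (𝔔₁f B) v' + (Xbf B) v * (𝔔₀ B) * (-(c • Matrix.diagonal (fun b : (↥(pbox (towerTorus Lc (M' B) (n + 1))) × Fin (d + 1)) => (lv B) v' b.1)))) + ((𝔔₂f B) v v' + (𝔔₁f B) v * (-(c • Matrix.diagonal (fun b : (↥(pbox (towerTorus Lc (M' B) (n + 1))) × Fin (d + 1)) => (lv B) v' b.1))) + ((𝔔₁f B) v * (-(c • Matrix.diagonal (fun b : (↥(pbox (towerTorus Lc (M' B) (n + 1))) × Fin (d + 1)) => (lv B) v' b.1))) + (𝔔₀ B) * ((-(c • Matrix.diagonal (fun b : (↥(pbox (towerTorus Lc (M' B) (n + 1))) × Fin (d + 1)) => (lv B) v b.1))) * (-(c • Matrix.diagonal (fun b : (↥(pbox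 (towerTorus Lc (M' B) (n + 1))) × Fin (d + 1)) => (lv B) v' b.1))))))))
    -- #21's generator jets by their closed forms at `h := hv v` (weight `h`), per direction
    (W₁f W₂f : ∀ B : ℕ, (V B) → Matrix (↥(pbox (towerTorus Lc (M' B) (n + 1))) × Fin (d + 1)) (NParam Lc (M' B) rs (n + 1)) ℝ)
    (hW₁f : ∀ B : ℕ, ∀ v, (W₁f B) v = Matrix.of fun (b : (↥(pbox (towerTorus Lc (M' B) (n + 1))) × Fin (d + 1))) (e : (NParam Lc (M' B) rs (n + 1))) => -(c * (hv B) v b * evalN Lc (M' B) rs (n + 1) (fun b' : (↥(pbox (towerTorus Lc (M' B) (n + 1))) × Fin (d + 1)) => (b'.1 : Site (d + 1)) + unitVec b'.2) b e))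
    (hW₂f : ∀ B : ℕ, ∀ v, (W₂f B) v = Matrix.of fun (b : (↥(pbox (towerTorus Lc (M' B) (n + 1))) × Fin (d + 1))) (e : (NParam Lc (M' B) rs (n + 1))) => (c * (hv B) v b) ^ 2 * evalN Lc (M' B) rs (n + 1) (fun b' : (↥(pbox (towerTorus Lc (M' B) (n + 1))) × Fin (d + 1)) => (b'.1 : Site (d + 1)) + unitVec b'.2) b e)
    -- the (COV-m) order-1∕2 images and the (WARD-m) sources, per direction (free)
    (Db₁f Db₂f : ∀ B : ℕ, (V B) → Matrix (↥(pbox (M' B)) × Fin (d + 1)) (Res (toSite (rs 0)) Lc (M' B)) ℝ)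
    (Y₁f Y₂f : ∀ B : ℕ, (V B) → Matrix (κ B) (NParam Lc (M' B) rs (n + 1)) ℝ)
    -- the `G`-side DRESSED WORDS, NAMED (#36b's shapes at `B := [Q₁₁f v; 0]`)
    (Gw₁f : ∀ B : ℕ, (V B) → Matrix (↥(pbox (M' B)) × Fin (d + 1)) (↥(pbox (M' B)) × Fin (d + 1)) ℝ)
    (hGw₁f : ∀ B : ℕ, ∀ v, (Gw₁f B) v = (((L B) * ((H₁f B) v) - (S B) * (fromRows ((Q₁₁f B) v) (0 : Matrix (NParam Lc (fine Lc (M' B)) (fun k => rs (k + 1)) n) (↥(pbox (towerTorus Lc (M' B) (n + 1))) × Fin (d + 1)) ℝ))) * (I B) + (L B) * (fromRows ((Q₁₁f B) v) (0 : Matrix (NParam Lc (fine Lc (M' B)) (fun k => rs (k + 1)) n) (↥(pbox (towerTorus Lc (M' B) (n + 1))) × Fin (d + 1)) ℝ))ᵀ * (S B)).toBlocks₁₁)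
    (Gw₂f : ∀ B : ℕ, (V B) → (V B) → Matrix (↥(pbox (M' B)) × Fin (d + 1)) (↥(pbox (M' B)) × Fin (d + 1)) ℝ)
    (hGw₂f : ∀ B : ℕ, ∀ v v', (Gw₂f B) v v' =
      ((((-(((L B) * ((H₁f B) v) - (S B) * (fromRows ((Q₁₁f B) v) (0 : Matrix (NParam Lc (fine Lc (M' B)) (fun k => rs (k + 1)) n) (↥(pbox (towerTorus Lc (M' B) (n + 1))) × Fin (d + 1)) ℝ))) * (Γ B) - (L B) * (fromRows ((Q₁₁f B) v) (0 : Matrix (NParam Lc (fine Lc (M' B)) (fun k => rs (k + 1)) n) (↥(pbox (towerTorus Lc (M' B) (n + 1))) × Fin (d + 1)) ℝ))ᵀ * (L B)) * ((H₁f B) v') + (L B) * ((H₂f B) v v')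
          - ((((L B) * ((H₁f B) v) - (S B) * (fromRows ((Q₁₁f B) v) (0 : Matrix (NParam Lc (fine Lc (M' B)) (fun k => rs (k + 1)) n) (↥(pbox (towerTorus Lc (M' B) (n + 1))) × Fin (d + 1)) ℝ))) * (I B) + (L B) * (fromRows ((Q₁₁f B) v) (0 : Matrix (NParam Lc (fine Lc (M' B)) (fun k => rs (k + 1)) n) (↥(pbox (towerTorus Lc (M' B) (n + 1))) × Fin (d + 1)) ℝ))ᵀ * (S B)) * (fromRows ((Q₁₁f B) v') (0 : Matrix (NParam Lc (fine Lc (M' B)) (fun k => rs (k + 1)) n) (↥(pbox (towerTorus Lc (M' B) (n + 1))) × Fin (d + 1)) ℝ)) + (S B) * (fromRows ((Q₁₂f B) v v') (0 : Matrix (NParam Lc (fine Lc (M' B)) (fun k => rs (k + 1)) n) (↥(pbox (towerTorus Lc (M' B) (n + 1))) × Fin (d + 1)) ℝ)))) * (I B)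
        + ((L B) * ((H₁f B) v) - (S B) * (fromRows ((Q₁₁f B) v) (0 : Matrix (NParam Lc (fine Lc (M' B)) (fun k => rs (k + 1)) n) (↥(pbox (towerTorus Lc (M' B) (n + 1))) × Fin (d + 1)) ℝ))) * (-(((Γ B) * ((H₁f B) v') + (I B) * (fromRows ((Q₁₁f B) v') (0 : Matrix (NParam Lc (fine Lc (M' B)) (fun k => rs (k + 1)) n) (↥(pbox (towerTorus Lc (M' B) (n + 1))) × Fin (d + 1)) ℝ))) * (I B) + (Γ B) * (fromRows ((Q₁₁f B) v') (0 : Matrix (NParam Lc (fine Lc (M' B)) (fun k => rs (k + 1)) n) (↥(pbox (towerTorus Lc (M' B) (n + 1))) × Fin (d + 1)) ℝ))ᵀ * (S B))))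
      - ((-(((L B) * ((H₁f B) v) - (S B) * (fromRows ((Q₁₁f B) v) (0 : Matrix (NParam Lc (fine Lc (M' B)) (fun k => rs (k + 1)) n) (↥(pbox (towerTorus Lc (M' B) (n + 1))) × Fin (d + 1)) ℝ))) * (Γ B) - (L B) * (fromRows ((Q₁₁f B) v) (0 : Matrix (NParam Lc (fine Lc (M' B)) (fun k => rs (k + 1)) n) (↥(pbox (towerTorus Lc (M' B) (n + 1))) × Fin (d + 1)) ℝ))ᵀ * (L B)) * (-(fromRows ((Q₁₁f B) v') (0 : Matrix (NParam Lc (fine Lc (M' B)) (fun k => rs (k + 1)) n) (↥(pbox (towerTorus Lc (M' B) (n + 1))) × Fin (d + 1)) ℝ))ᵀ) + (L B) * (fromRows ((Q₁₂f B) v v') (0 : Matrix (NParam Lc (fine Lc (M' B)) (fun k => rs (k + 1)) n) (↥(pbox (towerTorus Lc (M' B) (n + 1))) × Fin (d + 1)) ℝ))ᵀ) * (S B)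
          + (L B) * (-(fromRows ((Q₁₁f B) v) (0 : Matrix (NParam Lc (fine Lc (M' B)) (fun k => rs (k + 1)) n) (↥(pbox (towerTorus Lc (M' B) (n + 1))) × Fin (d + 1)) ℝ))ᵀ) * (((L B) * ((H₁f B) v') - (S B) * (fromRows ((Q₁₁f B) v') (0 : Matrix (NParam Lc (fine Lc (M' B)) (fun k => rs (k + 1)) n) (↥(pbox (towerTorus Lc (M' B) (n + 1))) × Fin (d + 1)) ℝ))) * (I B) + (L B) * (fromRows ((Q₁₁f B) v') (0 : Matrix (NParam Lc (fine Lc (M' B)) (fun k => rs (k + 1)) n) (↥(pbox (towerTorus Lc (M' B) (n + 1))) × Fin (d + 1)) ℝ))ᵀ * (S B))))).toBlocks₁₁)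
    -- #21's ROWS, FOR EVERY DIRECTION: the coarse chart's Faddeev–Popov 2-jet, the form parities, the graded Ward rows, (COV-m) orders 1, 2 on both levels
    (uTop : ∀ B : ℕ, ∀ v, secondVar ((τ₂ B) * (Dbar B)) ((τ₂ B) * (Db₁f B) v) ((τ₂ B) * (Db₂f B) v) = 0)
    (hH₁t : ∀ B : ℕ, ∀ v, ((H₁f B) v)ᵀ = -(H₁f B) v)
    (hH₂t : ∀ B : ℕ, ∀ v, ((H₂f B) v v)ᵀ = (H₂f B) v v)
    -- (WARD-m) ORDER 0 and the top step's (COV-m) ORDER 0 — direction-free, DISPLAYED for the abstract families (rooted: `torus_a0_tower` ∕ `Qtop_mul_smul_tgrad_res`)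
    (a0 : ∀ B : ℕ, (H₀ B) * (W₀ B) = 0)
    (d0 : ∀ B : ℕ, (Q₂₀ B) * (Dbar B) = 0)
    (a1 : ∀ B : ℕ, ∀ v, (H₁f B) v * (W₀ B) + (H₀ B) * (W₁f B) v = (𝔔₀ B)ᵀ * (Y₁f B) v)
    (a2 : ∀ B : ℕ, ∀ v, (H₂f B) v v * (W₀ B) + (2 : ℝ) • ((H₁f B) v * (W₁f B) v) + (H₀ B) * (W₂f B) v = -((2 : ℝ) • (((𝔔₁f B) v)ᵀ * (Y₁f B) v)) + (𝔔₀ B)ᵀ * (Y₂f B) v)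
    (c1 : ∀ B : ℕ, ∀ v, (Q₁₁f B) v * (W₀ B) + (Q₁₀ B) * (W₁f B) v = fromCols ((Db₁f B) v) (0 : Matrix (↥(pbox (M' B)) × Fin (d + 1)) (NParam Lc (fine Lc (M' B)) (fun k => rs (k + 1)) n) ℝ))
    (c2 : ∀ B : ℕ, ∀ v, (Q₁₂f B) v v * (W₀ B) + (2 : ℝ) • ((Q₁₁f B) v * (W₁f B) v) + (Q₁₀ B) * (W₂f B) v = fromCols ((Db₂f B) v) (0 : Matrix (↥(pbox (M' B)) × Fin (d + 1)) (NParam Lc (fine Lc (M' B)) (fun k => rs (k + 1)) n) ℝ))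
    (d1 : ∀ B : ℕ, ∀ v, (Q₂₁f B) v * (Dbar B) + (Q₂₀ B) * (Db₁f B) v = 0)
    (d2 : ∀ B : ℕ, ∀ v, (Q₂₂f B) v v * (Dbar B) + (2 : ℝ) • ((Q₂₁f B) v * (Db₁f B) v) + (Q₂₀ B) * (Db₂f B) v = 0)
    -- a finite family of direction LABELS (box-free) read in every box's direction module, and the pair bound to the base points `(μ, 0)`, `(ν, z)`
    {σ : Type*} [Fintype σ] [DecidableEq σ] (dv : ∀ B : ℕ, σ → V B) (a₁ a₂ : σ)
    -- (S3-1) N — per box: the ONE-SHOT system of depth `n+2`, right inverse and LEG over the box-free chart kernel `A_N` under the torus rules (DISPLAYED);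
    -- (P2‴)'s lattice letters of `A_N`: decay + blocking-`Lc^(n+2)` covariance (#42a VERBATIM)
    {XN : ∀ B : ℕ, Matrix ((↥(pbox (towerTorus Lc (M' B) (n + 1))) × Fin (d + 1)) ⊕ (κ B ⊕ (NParam Lc (M' B) rs (n + 1)))) ((↥(pbox (towerTorus Lc (M' B) (n + 1))) × Fin (d + 1)) ⊕ (κ B ⊕ (NParam Lc (M' B) rs (n + 1)))) ℝ} (hXN : ∀ B : ℕ, kkt (H₀ B) (fromRows (𝔔₀ B) (P B)) * XN B = 1)
    (ρN : Fin (d + 1) → ℤ) (LNc : ℕ) (fN : ∀ B : ℕ, κ B → Idx (towerTorus Lc (M' B) (n + 1)) (Fib d)) (hfN : ∀ B : ℕ, Function.Injective (fN B))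
    (hmN : ∀ B : ℕ, ∀ a : κ B, ∃ m : Fin (d + 1), (fN B a).2 = Sum.inr m)
    (hcN : ∀ B : ℕ, ∀ (s : ↥(pbox (towerTorus Lc (M' B) (n + 1)))) (m : Fin (d + 1)), ((s, Sum.inr m) : Idx (towerTorus Lc (M' B) (n + 1)) (Fib d)) ∈ Set.range (fN B) ↔ Torus.proj LNc (s : Site (d + 1)) = 0)
    {AN : MKer (d + 1) (Fib d)} {CAN αN : ℝ} (hAN : Decays AN CAN αN) (hαN : 0 < αN)
    (hANsh : ∀ t : Fin (d + 1) → ℤ, shiftK (((Lc ^ (n + 2) : ℕ) : ℤ) • t) AN = AN)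
    (hEAN : ∀ B : ℕ, perF (towerTorus Lc (M' B) (n + 1)) (axEc ρN LNc) * perF (towerTorus Lc (M' B) (n + 1)) AN = perF (towerTorus Lc (M' B) (n + 1)) AN)
    (hAEN : ∀ B : ℕ, perF (towerTorus Lc (M' B) (n + 1)) AN * perF (towerTorus Lc (M' B) (n + 1)) (axEc ρN LNc) = perF (towerTorus Lc (M' B) (n + 1)) AN)
    (hLN : ∀ B : ℕ, (XN B).submatrix (Sum.map id Sum.inl) (Sum.map id Sum.inl) = fromBlocks
      (Matrix.of fun (b b' : (↥(pbox (towerTorus Lc (M' B) (n + 1))) × Fin (d + 1))) =>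
        axEc ρN LNc (b.1 : Site (d + 1)) (b.1 : Site (d + 1)) (Sum.inl b.2) (Sum.inl b.2)
          * (axEc ρN LNc (b'.1 : Site (d + 1)) (b'.1 : Site (d + 1)) (Sum.inl b'.2) (Sum.inl b'.2) * perF (towerTorus Lc (M' B) (n + 1)) AN (b.1, Sum.inl b.2) (b'.1, Sum.inl b'.2)))
      (Matrix.of fun (b : (↥(pbox (towerTorus Lc (M' B) (n + 1))) × Fin (d + 1))) (a : κ B) =>
        axEc ρN LNc (b.1 : Site (d + 1)) (b.1 : Site (d + 1)) (Sum.inl b.2) (Sum.inl b.2) * perF (towerTorus Lc (M' B) (n + 1)) AN (b.1, Sum.inl b.2) ((fN B) a))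
      (-Matrix.of fun (a : κ B) (b : (↥(pbox (towerTorus Lc (M' B) (n + 1))) × Fin (d + 1))) =>
        axEc ρN LNc (b.1 : Site (d + 1)) (b.1 : Site (d + 1)) (Sum.inl b.2) (Sum.inl b.2) * perF (towerTorus Lc (M' B) (n + 1)) AN ((fN B) a) (b.1, Sum.inl b.2))
      (-((perF (towerTorus Lc (M' B) (n + 1)) AN).submatrix (fN B) (fN B))))
    -- (S3-2) N — the lattice base-point jets `𝒱_N (μ,0)`, `𝒱_N (ν,z)`, `𝒲_N (μ,0;ν,z)`: bi-localised ((P2‴)), and PER BOX their periodisations carry the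
    -- parities and ARE the door's `N` jets in the directions `a₁ a₂` on the blocks (the (C1) namings DISPLAYED) (#42a VERBATIM)
    {pN pN' qN qN' : Fin (d + 1) → ℤ} {CvN CvN' CwN δN : ℝ}
    (hVN : BiLoc (𝒱N μ 0) pN pN' CvN δN) (hVN' : BiLoc (𝒱N ν z) qN' qN CvN' δN) (hWN : BiLoc (𝒲N μ 0 ν z) pN qN CwN δN) (hδN : 0 < δN)
    (hVNm : ∀ B : ℕ, ∀ a a' : κ B, (perF (towerTorus Lc (M' B) (n + 1)) (dper (towerTorus Lc (M' B) (n + 1)) (𝒱N μ 0))) ((fN B) a) ((fN B) a') = 0)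
    (hVNt : ∀ B : ℕ, ∀ (b : (↥(pbox (towerTorus Lc (M' B) (n + 1))) × Fin (d + 1))) (a : κ B), (perF (towerTorus Lc (M' B) (n + 1)) (dper (towerTorus Lc (M' B) (n + 1)) (𝒱N μ 0))) (b.1, Sum.inl b.2) ((fN B) a) = (perF (towerTorus Lc (M' B) (n + 1)) (dper (towerTorus Lc (M' B) (n + 1)) (𝒱N μ 0))) ((fN B) a) (b.1, Sum.inl b.2))
    (hVN'm : ∀ B : ℕ, ∀ a a' : κ B, (perF (towerTorus Lc (M' B) (n + 1)) (dper (towerTorus Lc (M' B) (n + 1)) (𝒱N ν z))) ((fN B) a) ((fN B) a') = 0)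
    (hVN't : ∀ B : ℕ, ∀ (b : (↥(pbox (towerTorus Lc (M' B) (n + 1))) × Fin (d + 1))) (a : κ B), (perF (towerTorus Lc (M' B) (n + 1)) (dper (towerTorus Lc (M' B) (n + 1)) (𝒱N ν z))) (b.1, Sum.inl b.2) ((fN B) a) = (perF (towerTorus Lc (M' B) (n + 1)) (dper (towerTorus Lc (M' B) (n + 1)) (𝒱N ν z))) ((fN B) a) (b.1, Sum.inl b.2))
    (hWNm : ∀ B : ℕ, ∀ a a' : κ B, (perF (towerTorus Lc (M' B) (n + 1)) (dper (towerTorus Lc (M' B) (n + 1)) (𝒲N μ 0 ν z))) ((fN B) a) ((fN B) a') = 0)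
    (hWNt : ∀ B : ℕ, ∀ (b : (↥(pbox (towerTorus Lc (M' B) (n + 1))) × Fin (d + 1))) (a : κ B), (perF (towerTorus Lc (M' B) (n + 1)) (dper (towerTorus Lc (M' B) (n + 1)) (𝒲N μ 0 ν z))) (b.1, Sum.inl b.2) ((fN B) a) = -(perF (towerTorus Lc (M' B) (n + 1)) (dper (towerTorus Lc (M' B) (n + 1)) (𝒲N μ 0 ν z))) ((fN B) a) (b.1, Sum.inl b.2))
    (hHN₁ : ∀ B : ℕ, H'₁f B (dv B a₁) = (perF (towerTorus Lc (M' B) (n + 1)) (dper (towerTorus Lc (M' B) (n + 1)) (𝒱N μ 0))).submatrix (fun b : (↥(pbox (towerTorus Lc (M' B) (n + 1))) × Fin (d + 1)) => ((b.1, Sum.inl b.2) : Idx (towerTorus Lc (M' B) (n + 1)) (Fib d))) (fun b : (↥(pbox (towerTorus Lc (M' B) (n + 1))) × Fin (d + 1)) => ((b.1, Sum.inl b.2) : Idx (towerTorus Lc (M' B) (n + 1)) (Fib d))))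
    (hQN₁ : ∀ B : ℕ, 𝔔'₁f B (dv B a₁) = (perF (towerTorus Lc (M' B) (n + 1)) (dper (towerTorus Lc (M' B) (n + 1)) (𝒱N μ 0))).submatrix (fN B) (fun b : (↥(pbox (towerTorus Lc (M' B) (n + 1))) × Fin (d + 1)) => ((b.1, Sum.inl b.2) : Idx (towerTorus Lc (M' B) (n + 1)) (Fib d))))
    (hHN₁' : ∀ B : ℕ, H'₁f B (dv B a₂) = (perF (towerTorus Lc (M' B) (n + 1)) (dper (towerTorus Lc (M' B) (n + 1)) (𝒱N ν z))).submatrix (fun b : (↥(pbox (towerTorus Lc (M' B) (n + 1))) × Fin (d + 1)) => ((b.1, Sum.inl b.2) : Idx (towerTorus Lc (M' B) (n + 1)) (Fib d))) (fun b : (↥(pbox (towerTorus Lc (M' B) (n + 1))) × Fin (d + 1)) => ((b.1, Sum.inl b.2) : Idx (towerTorus Lc (M' B) (n + 1)) (Fib d))))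
    (hQN₁' : ∀ B : ℕ, 𝔔'₁f B (dv B a₂) = (perF (towerTorus Lc (M' B) (n + 1)) (dper (towerTorus Lc (M' B) (n + 1)) (𝒱N ν z))).submatrix (fN B) (fun b : (↥(pbox (towerTorus Lc (M' B) (n + 1))) × Fin (d + 1)) => ((b.1, Sum.inl b.2) : Idx (towerTorus Lc (M' B) (n + 1)) (Fib d))))
    (hHN₂ : ∀ B : ℕ, (1 / 2 : ℝ) • (H'₂f B (dv B a₁) (dv B a₂) + H'₂f B (dv B a₂) (dv B a₁)) = (perF (towerTorus Lc (M' B) (n + 1)) (dper (towerTorus Lc (M' B) (n + 1)) (𝒲N μ 0 ν z))).submatrix (fun b : (↥(pbox (towerTorus Lc (M' B) (n + 1))) × Fin (d + 1)) => ((b.1, Sum.inl b.2) : Idx (towerTorus Lc (M' B) (n + 1)) (Fib d))) (fun b : (↥(pbox (towerTorus Lc (M' B) (n + 1))) × Fin (d + 1)) => ((b.1, Sum.inl b.2) : Idx (towerTorus Lc (M' B) (n + 1)) (Fib d))))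
    (hQN₂ : ∀ B : ℕ, (1 / 2 : ℝ) • (𝔔'₂f B (dv B a₁) (dv B a₂) + 𝔔'₂f B (dv B a₂) (dv B a₁)) = (perF (towerTorus Lc (M' B) (n + 1)) (dper (towerTorus Lc (M' B) (n + 1)) (𝒲N μ 0 ν z))).submatrix (fN B) (fun b : (↥(pbox (towerTorus Lc (M' B) (n + 1))) × Fin (d + 1)) => ((b.1, Sum.inl b.2) : Idx (towerTorus Lc (M' B) (n + 1)) (Fib d))))
    -- (S3-1) F — per box: the ONE-SHOT system of the tower below (depth `n+1`, same finest torus), right inverse and LEG over `A_F` (DISPLAYED);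
    -- (P2‴)'s lattice letters of `A_F`: decay + blocking-`Lc^(n+1)` covariance (#42a VERBATIM)
    {XF : ∀ B : ℕ, Matrix ((↥(pbox (towerTorus Lc (M' B) (n + 1))) × Fin (d + 1)) ⊕ ((↥(pbox (M' B)) × Fin (d + 1)) ⊕ (NParam Lc (fine Lc (M' B)) (fun k => rs (k + 1)) n))) ((↥(pbox (towerTorus Lc (M' B) (n + 1))) × Fin (d + 1)) ⊕ ((↥(pbox (M' B)) × Fin (d + 1)) ⊕ (NParam Lc (fine Lc (M' B)) (fun k => rs (k + 1)) n))) ℝ} (hXF : ∀ B : ℕ, kkt (H₀ B) (fromRows (Q₁₀ B) (τ₁ B)) * XF B = 1)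
    (ρF : Fin (d + 1) → ℤ) (LFc : ℕ) (fF : ∀ B : ℕ, (↥(pbox (M' B)) × Fin (d + 1)) → Idx (towerTorus Lc (M' B) (n + 1)) (Fib d)) (hfF : ∀ B : ℕ, Function.Injective (fF B))
    (hmF : ∀ B : ℕ, ∀ a : (↥(pbox (M' B)) × Fin (d + 1)), ∃ m : Fin (d + 1), (fF B a).2 = Sum.inr m)
    (hcF : ∀ B : ℕ, ∀ (s : ↥(pbox (towerTorus Lc (M' B) (n + 1)))) (m : Fin (d + 1)), ((s, Sum.inr m) : Idx (towerTorus Lc (M' B) (n + 1)) (Fib d)) ∈ Set.range (fF B) ↔ Torus.proj LFc (s : Site (d + 1)) = 0)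
    {AF : MKer (d + 1) (Fib d)} {CAF αF : ℝ} (hAF : Decays AF CAF αF) (hαF : 0 < αF)
    (hAFsh : ∀ t : Fin (d + 1) → ℤ, shiftK (((Lc ^ (n + 1) : ℕ) : ℤ) • t) AF = AF)
    (hEAF : ∀ B : ℕ, perF (towerTorus Lc (M' B) (n + 1)) (axEc ρF LFc) * perF (towerTorus Lc (M' B) (n + 1)) AF = perF (towerTorus Lc (M' B) (n + 1)) AF)
    (hAEF : ∀ B : ℕ, perF (towerTorus Lc (M' B) (n + 1)) AF * perF (towerTorus Lc (M' B) (n + 1)) (axEc ρF LFc) = perF (towerTorus Lc (M' B) (n + 1)) AF)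
    (hLF : ∀ B : ℕ, (XF B).submatrix (Sum.map id Sum.inl) (Sum.map id Sum.inl) = fromBlocks
      (Matrix.of fun (b b' : (↥(pbox (towerTorus Lc (M' B) (n + 1))) × Fin (d + 1))) =>
        axEc ρF LFc (b.1 : Site (d + 1)) (b.1 : Site (d + 1)) (Sum.inl b.2) (Sum.inl b.2)
          * (axEc ρF LFc (b'.1 : Site (d + 1)) (b'.1 : Site (d + 1)) (Sum.inl b'.2) (Sum.inl b'.2) * perF (towerTorus Lc (M' B) (n + 1)) AF (b.1, Sum.inl b.2) (b'.1, Sum.inl b'.2)))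
      (Matrix.of fun (b : (↥(pbox (towerTorus Lc (M' B) (n + 1))) × Fin (d + 1))) (a : (↥(pbox (M' B)) × Fin (d + 1))) =>
        axEc ρF LFc (b.1 : Site (d + 1)) (b.1 : Site (d + 1)) (Sum.inl b.2) (Sum.inl b.2) * perF (towerTorus Lc (M' B) (n + 1)) AF (b.1, Sum.inl b.2) ((fF B) a))
      (-Matrix.of fun (a : (↥(pbox (M' B)) × Fin (d + 1))) (b : (↥(pbox (towerTorus Lc (M' B) (n + 1))) × Fin (d + 1))) =>
        axEc ρF LFc (b.1 : Site (d + 1)) (b.1 : Site (d + 1)) (Sum.inl b.2) (Sum.inl b.2) * perF (towerTorus Lc (M' B) (n + 1)) AF ((fF B) a) (b.1, Sum.inl b.2))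
      (-((perF (towerTorus Lc (M' B) (n + 1)) AF).submatrix (fF B) (fF B))))
    -- (S3-2) F — the lattice base-point jets of the tower below: bi-localised, and PER BOX their periodisations ARE the door's fine jets in the directions `a₁ a₂`
    {pF pF' qF qF' : Fin (d + 1) → ℤ} {CvF CvF' CwF δF : ℝ}
    (hVF : BiLoc (𝒱F μ 0) pF pF' CvF δF) (hVF' : BiLoc (𝒱F ν z) qF' qF CvF' δF) (hWF : BiLoc (𝒲F μ 0 ν z) pF qF CwF δF) (hδF : 0 < δF)
    (hVFm : ∀ B : ℕ, ∀ a a' : (↥(pbox (M' B)) × Fin (d + 1)), (perF (towerTorus Lc (M' B) (n + 1)) (dper (towerTorus Lc (M' B) (n + 1)) (𝒱F μ 0))) ((fF B) a) ((fF B) a') = 0)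
    (hVFt : ∀ B : ℕ, ∀ (b : (↥(pbox (towerTorus Lc (M' B) (n + 1))) × Fin (d + 1))) (a : (↥(pbox (M' B)) × Fin (d + 1))), (perF (towerTorus Lc (M' B) (n + 1)) (dper (towerTorus Lc (M' B) (n + 1)) (𝒱F μ 0))) (b.1, Sum.inl b.2) ((fF B) a) = (perF (towerTorus Lc (M' B) (n + 1)) (dper (towerTorus Lc (M' B) (n + 1)) (𝒱F μ 0))) ((fF B) a) (b.1, Sum.inl b.2))
    (hVF'm : ∀ B : ℕ, ∀ a a' : (↥(pbox (M' B)) × Fin (d + 1)), (perF (towerTorus Lc (M' B) (n + 1)) (dper (towerTorus Lc (M' B) (n + 1)) (𝒱F ν z))) ((fF B) a) ((fF B) a') = 0)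
    (hVF't : ∀ B : ℕ, ∀ (b : (↥(pbox (towerTorus Lc (M' B) (n + 1))) × Fin (d + 1))) (a : (↥(pbox (M' B)) × Fin (d + 1))), (perF (towerTorus Lc (M' B) (n + 1)) (dper (towerTorus Lc (M' B) (n + 1)) (𝒱F ν z))) (b.1, Sum.inl b.2) ((fF B) a) = (perF (towerTorus Lc (M' B) (n + 1)) (dper (towerTorus Lc (M' B) (n + 1)) (𝒱F ν z))) ((fF B) a) (b.1, Sum.inl b.2))
    (hWFm : ∀ B : ℕ, ∀ a a' : (↥(pbox (M' B)) × Fin (d + 1)), (perF (towerTorus Lc (M' B) (n + 1)) (dper (towerTorus Lc (M' B) (n + 1)) (𝒲F μ 0 ν z))) ((fF B) a) ((fF B) a') = 0)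
    (hWFt : ∀ B : ℕ, ∀ (b : (↥(pbox (towerTorus Lc (M' B) (n + 1))) × Fin (d + 1))) (a : (↥(pbox (M' B)) × Fin (d + 1))), (perF (towerTorus Lc (M' B) (n + 1)) (dper (towerTorus Lc (M' B) (n + 1)) (𝒲F μ 0 ν z))) (b.1, Sum.inl b.2) ((fF B) a) = -(perF (towerTorus Lc (M' B) (n + 1)) (dper (towerTorus Lc (M' B) (n + 1)) (𝒲F μ 0 ν z))) ((fF B) a) (b.1, Sum.inl b.2))
    (hHF₁ : ∀ B : ℕ, H₁f B (dv B a₁) = (perF (towerTorus Lc (M' B) (n + 1)) (dper (towerTorus Lc (M' B) (n + 1)) (𝒱F μ 0))).submatrix (fun b : (↥(pbox (towerTorus Lc (M' B) (n + 1))) × Fin (d + 1)) => ((b.1, Sum.inl b.2) : Idx (towerTorus Lc (M' B) (n + 1)) (Fib d))) (fun b : (↥(pbox (towerTorus Lc (M' B) (n + 1))) × Fin (d + 1)) => ((b.1, Sum.inl b.2) : Idx (towerTorus Lc (M' B) (n + 1)) (Fib d))))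
    (hQF₁ : ∀ B : ℕ, Q₁₁f B (dv B a₁) = (perF (towerTorus Lc (M' B) (n + 1)) (dper (towerTorus Lc (M' B) (n + 1)) (𝒱F μ 0))).submatrix (fF B) (fun b : (↥(pbox (towerTorus Lc (M' B) (n + 1))) × Fin (d + 1)) => ((b.1, Sum.inl b.2) : Idx (towerTorus Lc (M' B) (n + 1)) (Fib d))))
    (hHF₁' : ∀ B : ℕ, H₁f B (dv B a₂) = (perF (towerTorus Lc (M' B) (n + 1)) (dper (towerTorus Lc (M' B) (n + 1)) (𝒱F ν z))).submatrix (fun b : (↥(pbox (towerTorus Lc (M' B) (n + 1))) × Fin (d + 1)) => ((b.1, Sum.inl b.2) : Idx (towerTorus Lc (M' B) (n + 1)) (Fib d))) (fun b : (↥(pbox (towerTorus Lc (M' B) (n + 1))) × Fin (d + 1)) => ((b.1, Sum.inl b.2) : Idx (towerTorus Lc (M' B) (n + 1)) (Fib d))))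
    (hQF₁' : ∀ B : ℕ, Q₁₁f B (dv B a₂) = (perF (towerTorus Lc (M' B) (n + 1)) (dper (towerTorus Lc (M' B) (n + 1)) (𝒱F ν z))).submatrix (fF B) (fun b : (↥(pbox (towerTorus Lc (M' B) (n + 1))) × Fin (d + 1)) => ((b.1, Sum.inl b.2) : Idx (towerTorus Lc (M' B) (n + 1)) (Fib d))))
    (hHF₂ : ∀ B : ℕ, (1 / 2 : ℝ) • (H₂f B (dv B a₁) (dv B a₂) + H₂f B (dv B a₂) (dv B a₁)) = (perF (towerTorus Lc (M' B) (n + 1)) (dper (towerTorus Lc (M' B) (n + 1)) (𝒲F μ 0 ν z))).submatrix (fun b : (↥(pbox (towerTorus Lc (M' B) (n + 1))) × Fin (d + 1)) => ((b.1, Sum.inl b.2) : Idx (towerTorus Lc (M' B) (n + 1)) (Fib d))) (fun b : (↥(pbox (towerTorus Lc (M' B) (n + 1))) × Fin (d + 1)) => ((b.1, Sum.inl b.2) : Idx (towerTorus Lc (M' B) (n + 1)) (Fib d))))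
    (hQF₂ : ∀ B : ℕ, (1 / 2 : ℝ) • (Q₁₂f B (dv B a₁) (dv B a₂) + Q₁₂f B (dv B a₂) (dv B a₁)) = (perF (towerTorus Lc (M' B) (n + 1)) (dper (towerTorus Lc (M' B) (n + 1)) (𝒲F μ 0 ν z))).submatrix (fF B) (fun b : (↥(pbox (towerTorus Lc (M' B) (n + 1))) × Fin (d + 1)) => ((b.1, Sum.inl b.2) : Idx (towerTorus Lc (M' B) (n + 1)) (Fib d))))
    -- (S3-1) G — NEW IN THE `-G` EDITION, per box: the TOP COMB system over the ABSTRACT form `K (lev 0) (rs 0)`, a right inverse of the UNSCALED comb-KKT and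
    -- its LEG over the box-free chart kernel `A_G` under the torus rules on `M′ B`, the multipliers' packing injection `f_G` (DISPLAYED — rooted: #41b at
    -- `A_G := Π̂ᵀ(KInvStep Lc (lev 0))Π̂ @ rs 0`; sym: leaf-05's sym comb leg); (P2‴)'s lattice letters of `A_G`: decay + blocking-`Lc` covariance (DISPLAYED —
    -- rooted: an2's `decays_coDressKBmAt_KInvStep ∕ shiftK_coDressKBmAt_KInvStep`, the pair leaf-06's §3 `_coDress` discharged inside #42a; sym: the sym chart's)
    {XG : ∀ B : ℕ, Matrix ((↥(pbox (M' B)) × Fin (d + 1)) ⊕ (κ B ⊕ (Res (toSite (rs 0)) Lc (M' B)))) ((↥(pbox (M' B)) × Fin (d + 1)) ⊕ (κ B ⊕ (Res (toSite (rs 0)) Lc (M' B)))) ℝ}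
    (hXG : ∀ B : ℕ, kkt ((perF (M' B) (K (lev 0) (rs 0))).submatrix (fun b : (↥(pbox (M' B)) × Fin (d + 1)) => ((b.1, Sum.inl b.2) : Idx (M' B) (Fib d))) (fun b : (↥(pbox (M' B)) × Fin (d + 1)) => ((b.1, Sum.inl b.2) : Idx (M' B) (Fib d)))) (fromRows (Q₂₀ B) (τ₂ B)) * XG B = 1)
    (ρG : Fin (d + 1) → ℤ) (LGc : ℕ) (fG : ∀ B : ℕ, κ B → Idx (M' B) (Fib d)) (hfG : ∀ B : ℕ, Function.Injective (fG B))
    (hmG : ∀ B : ℕ, ∀ a : κ B, ∃ m : Fin (d + 1), (fG B a).2 = Sum.inr m)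
    (hcG : ∀ B : ℕ, ∀ (s : ↥(pbox (M' B))) (m : Fin (d + 1)), ((s, Sum.inr m) : Idx (M' B) (Fib d)) ∈ Set.range (fG B) ↔ Torus.proj LGc (s : Site (d + 1)) = 0)
    {AG : MKer (d + 1) (Fib d)} {CAG αG : ℝ} (hAG : Decays AG CAG αG) (hαG : 0 < αG)
    (hAGsh : ∀ t : Fin (d + 1) → ℤ, shiftK ((Lc : ℤ) • t) AG = AG)
    (hEAG : ∀ B : ℕ, perF (M' B) (axEc ρG LGc) * perF (M' B) AG = perF (M' B) AG)
    (hAEG : ∀ B : ℕ, perF (M' B) AG * perF (M' B) (axEc ρG LGc) = perF (M' B) AG)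
    (hLG : ∀ B : ℕ, (XG B).submatrix (Sum.map id Sum.inl) (Sum.map id Sum.inl) = fromBlocks
      (Matrix.of fun (b b' : (↥(pbox (M' B)) × Fin (d + 1))) =>
        axEc ρG LGc (b.1 : Site (d + 1)) (b.1 : Site (d + 1)) (Sum.inl b.2) (Sum.inl b.2)
          * (axEc ρG LGc (b'.1 : Site (d + 1)) (b'.1 : Site (d + 1)) (Sum.inl b'.2) (Sum.inl b'.2) * perF (M' B) AG (b.1, Sum.inl b.2) (b'.1, Sum.inl b'.2)))
      (Matrix.of fun (b : (↥(pbox (M' B)) × Fin (d + 1))) (a : κ B) =>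
        axEc ρG LGc (b.1 : Site (d + 1)) (b.1 : Site (d + 1)) (Sum.inl b.2) (Sum.inl b.2) * perF (M' B) AG (b.1, Sum.inl b.2) ((fG B) a))
      (-Matrix.of fun (a : κ B) (b : (↥(pbox (M' B)) × Fin (d + 1))) =>
        axEc ρG LGc (b.1 : Site (d + 1)) (b.1 : Site (d + 1)) (Sum.inl b.2) (Sum.inl b.2) * perF (M' B) AG ((fG B) a) (b.1, Sum.inl b.2))
      (-((perF (M' B) AG).submatrix (fG B) (fG B))))
    -- (S3-2) G — the lattice base-point jets of the TOP STEP: bi-localised, and PER BOX their periodisations on `M′ B` ARE the door's `G` jets, the H-blocks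
    -- CARRYING THE UNIT `∏_{i<n+1} wVH d Lc (lev i)` (#41d-G) (#42a VERBATIM but for the abstract `f_G`)
    {pG pG' qG qG' : Fin (d + 1) → ℤ} {CvG CvG' CwG δG : ℝ}
    (hVG : BiLoc (𝒱G μ 0) pG pG' CvG δG) (hVG' : BiLoc (𝒱G ν z) qG' qG CvG' δG) (hWG : BiLoc (𝒲G μ 0 ν z) pG qG CwG δG) (hδG : 0 < δG)
    (hVGm : ∀ B : ℕ, ∀ a a' : κ B, (perF (M' B) (dper (M' B) (𝒱G μ 0))) ((fG B) a) ((fG B) a') = 0)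
    (hVGt : ∀ B : ℕ, ∀ (b : (↥(pbox (M' B)) × Fin (d + 1))) (a : κ B), (perF (M' B) (dper (M' B) (𝒱G μ 0))) (b.1, Sum.inl b.2) ((fG B) a) = (perF (M' B) (dper (M' B) (𝒱G μ 0))) ((fG B) a) (b.1, Sum.inl b.2))
    (hVG'm : ∀ B : ℕ, ∀ a a' : κ B, (perF (M' B) (dper (M' B) (𝒱G ν z))) ((fG B) a) ((fG B) a') = 0)
    (hVG't : ∀ B : ℕ, ∀ (b : (↥(pbox (M' B)) × Fin (d + 1))) (a : κ B), (perF (M' B) (dper (M' B) (𝒱G ν z))) (b.1, Sum.inl b.2) ((fG B) a) = (perF (M' B) (dper (M' B) (𝒱G ν z))) ((fG B) a) (b.1, Sum.inl b.2))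
    (hWGm : ∀ B : ℕ, ∀ a a' : κ B, (perF (M' B) (dper (M' B) (𝒲G μ 0 ν z))) ((fG B) a) ((fG B) a') = 0)
    (hWGt : ∀ B : ℕ, ∀ (b : (↥(pbox (M' B)) × Fin (d + 1))) (a : κ B), (perF (M' B) (dper (M' B) (𝒲G μ 0 ν z))) (b.1, Sum.inl b.2) ((fG B) a) = -(perF (M' B) (dper (M' B) (𝒲G μ 0 ν z))) ((fG B) a) (b.1, Sum.inl b.2))
    (hHG₁ : ∀ B : ℕ, (∏ i ∈ range (n + 1), wVH d Lc (lev i)) • Gw₁f B (dv B a₁) = (perF (M' B) (dper (M' B) (𝒱G μ 0))).submatrix (fun b : (↥(pbox (M' B)) × Fin (d + 1)) => ((b.1, Sum.inl b.2) : Idx (M' B) (Fib d))) (fun b : (↥(pbox (M' B)) × Fin (d + 1)) => ((b.1, Sum.inl b.2) : Idx (M' B) (Fib d))))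
    (hQG₁ : ∀ B : ℕ, Q₂₁f B (dv B a₁) = (perF (M' B) (dper (M' B) (𝒱G μ 0))).submatrix (fG B) (fun b : (↥(pbox (M' B)) × Fin (d + 1)) => ((b.1, Sum.inl b.2) : Idx (M' B) (Fib d))))
    (hHG₁' : ∀ B : ℕ, (∏ i ∈ range (n + 1), wVH d Lc (lev i)) • Gw₁f B (dv B a₂) = (perF (M' B) (dper (M' B) (𝒱G ν z))).submatrix (fun b : (↥(pbox (M' B)) × Fin (d + 1)) => ((b.1, Sum.inl b.2) : Idx (M' B) (Fib d))) (fun b : (↥(pbox (M' B)) × Fin (d + 1)) => ((b.1, Sum.inl b.2) : Idx (M' B) (Fib d))))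
    (hQG₁' : ∀ B : ℕ, Q₂₁f B (dv B a₂) = (perF (M' B) (dper (M' B) (𝒱G ν z))).submatrix (fG B) (fun b : (↥(pbox (M' B)) × Fin (d + 1)) => ((b.1, Sum.inl b.2) : Idx (M' B) (Fib d))))
    (hHG₂ : ∀ B : ℕ, (∏ i ∈ range (n + 1), wVH d Lc (lev i)) • ((1 / 2 : ℝ) • (Gw₂f B (dv B a₁) (dv B a₂) + Gw₂f B (dv B a₂) (dv B a₁))) = (perF (M' B) (dper (M' B) (𝒲G μ 0 ν z))).submatrix (fun b : (↥(pbox (M' B)) × Fin (d + 1)) => ((b.1, Sum.inl b.2) : Idx (M' B) (Fib d))) (fun b : (↥(pbox (M' B)) × Fin (d + 1)) => ((b.1, Sum.inl b.2) : Idx (M' B) (Fib d))))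
    (hQG₂ : ∀ B : ℕ, (1 / 2 : ℝ) • (Q₂₂f B (dv B a₁) (dv B a₂) + Q₂₂f B (dv B a₂) (dv B a₁)) = (perF (M' B) (dper (M' B) (𝒲G μ 0 ν z))).submatrix (fG B) (fun b : (↥(pbox (M' B)) × Fin (d + 1)) => ((b.1, Sum.inl b.2) : Idx (M' B) (Fib d))))
    : hessKer AN 𝒱N 𝒲N μ ν z
      = hessKer AF 𝒱F 𝒲F μ ν z + hessKer AG 𝒱G 𝒲G μ ν z :=
  hessKer_law_of_tower_hessT_law Lc M' hM'gr hM' n 𝒱N 𝒱F 𝒱G 𝒲N 𝒲F 𝒲G μ ν z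
    hAN hαN hANsh hVN hVN' hWN hδN hAF hαF hAFsh hVF hVF' hWF hδF hAG hαG hAGsh hVG hVG' hWG hδG
    fun B => hessT_fullIndex_law_tower_G (M' B) Lc lev rs n Q K (hrs := hrs) (hlev := hlev) (hM' := hM' B) (hH₀ := hH₀ B) (hQ₁₀ := hQ₁₀ B) (hτ₁ := hτ₁ B) (hH₀t := hH₀t B) (hone := hone) (hId := hId) (hSL := hSL B) (hτ₂ := hτ₂ B) (Q₂₀ := Q₂₀ B) (htop := htop B) (hW₀ := hW₀ B) (hP := hP B) (c := c) (hDbar := hDbar B) (c0 := c0 B) (hTW := hTW B) (hΓ := hΓ B) (hI := hI B) (hL := hL B) (hS := hS B) (h𝔔₀ := h𝔔₀ B) (hv := hv B) (lv := lv B) (hlv := hlv B) (Xbf := Xbf B) (hXbf := hXbf B) (H₁f := H₁f B) (hH₁l := hH₁l B) (Q₁₁f := Q₁₁f B) (hQ₁₁l := hQ₁₁l B) (Q₂₁f := Q₂₁f B) (hQ₂₁l := hQ₂₁l B) (H₂f := H₂f B) (hH₂l := hH₂l B) (hH₂r := hH₂r B) (Q₁₂f := Q₁₂f B) (hQ₁₂l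 := hQ₁₂l B) (hQ₁₂r := hQ₁₂r B) (Q₂₂f := Q₂₂f B) (hQ₂₂l := hQ₂₂l B) (hQ₂₂r := hQ₂₂r B) (𝔔₁f := 𝔔₁f B) (h𝔔₁ := h𝔔₁ B) (𝔔₂f := 𝔔₂f B) (h𝔔₂ := h𝔔₂ B) (H'₁f := H'₁f B) (hH'₁f := hH'₁f B) (H'₂f := H'₂f B) (hH'₂f := hH'₂f B) (𝔔'₁f := 𝔔'₁f B) (h𝔔'₁f := h𝔔'₁f B) (𝔔'₂f := 𝔔'₂f B) (h𝔔'₂f := h𝔔'₂f B) (W₁f := W₁f B) (W₂f := W₂f B) (hW₁f := hW₁f B) (hW₂f := hW₂f B) (Db₁f := Db₁f B) (Db₂f := Db₂f B) (Y₁f := Y₁f B) (Y₂f := Y₂f B) (Gw₁f := Gw₁f B) (hGw₁f := hGw₁f B) (Gw₂f := Gw₂f B) (hGw₂f := hGw₂f B) (uTop := uTop B) (hH₁t := hH₁t B) (hH₂t := hH₂t B) (a0 := a0 B) (d0 := d0 B) (a1 := a1 B) (a2 := a2 B) (c1 := c1 B) (c2 := c2 B) (d1 := d1 B) (d2 :=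 d2 B) (dv := dv B) (k := a₁) (l := a₂) (hXN := hXN B) (ρN := ρN) (LNc := LNc) (fN := fN B) (hfN := hfN B) (hmN := hmN B) (hcN := hcN B) (hEAN := hEAN B) (hAEN := hAEN B) (hLN := hLN B) (VN := (perF (towerTorus Lc (M' B) (n + 1)) (dper (towerTorus Lc (M' B) (n + 1)) (𝒱N μ 0)))) (VN' := (perF (towerTorus Lc (M' B) (n + 1)) (dper (towerTorus Lc (M' B) (n + 1)) (𝒱N ν z)))) (WN := (perF (towerTorus Lc (M' B) (n + 1)) (dper (towerTorus Lc (M' B) (n + 1)) (𝒲N μ 0 ν z)))) (hVNm := hVNm B) (hVNt := hVNt B) (hVN'm := hVN'm B) (hVN't := hVN't B) (hWNm := hWNm B) (hWNt := hWNt B) (hHN₁ := hHN₁ B) (hQN₁ := hQN₁ B) (hHN₁' := hHN₁' B) (hQN₁' := hQN₁' B) (hHN₂ := hHN₂ B) (hQN₂ := hQN₂ B) (hXF := hXF B) (ρF := ρF) (LFc := LFc) (fF := fF B) (hfF := hfF B) (hmF := hmF B) (hcF := hcF B) (hEAF := hEAF B) (hAEF := hAEF B) (hLF := hLF B) (VF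 := (perF (towerTorus Lc (M' B) (n + 1)) (dper (towerTorus Lc (M' B) (n + 1)) (𝒱F μ 0)))) (VF' := (perF (towerTorus Lc (M' B) (n + 1)) (dper (towerTorus Lc (M' B) (n + 1)) (𝒱F ν z)))) (WF := (perF (towerTorus Lc (M' B) (n + 1)) (dper (towerTorus Lc (M' B) (n + 1)) (𝒲F μ 0 ν z)))) (hVFm := hVFm B) (hVFt := hVFt B) (hVF'm := hVF'm B) (hVF't := hVF't B) (hWFm := hWFm B) (hWFt := hWFt B) (hHF₁ := hHF₁ B) (hQF₁ := hQF₁ B) (hHF₁' := hHF₁' B) (hQF₁' := hQF₁' B) (hHF₂ := hHF₂ B) (hQF₂ := hQF₂ B) (hXG := hXG B) (ρG := ρG) (LGc := LGc) (fG := fG B) (hfG := hfG B) (hmG := hmG B) (hcG := hcG B) (hEAG := hEAG B) (hAEG := hAEG B) (hLG := hLG B) (VG := (perF (M' B) (dper (M' B) (𝒱G μ 0)))) (VG' := (perF (M' B) (dper (M' B) (𝒱G ν z)))) (WG := (perF (M' B) (dper (M' B) (𝒲G μ 0 ν z)))) (hVGm := hVGm B) (hVGt := hVGt B) (hVG'm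 := hVG'm B) (hVG't := hVG't B) (hWGm := hWGm B) (hWGt := hWGt B) (hHG₁ := hHG₁ B) (hQG₁ := hQG₁ B) (hHG₁' := hHG₁' B) (hQG₁' := hQG₁' B) (hHG₂ := hHG₂ B) (hQG₂ := hQG₂ B)

end LawG

end Summit.QuantumFields.BalabanUV.Beta.FP.TowerKernelLawG

end
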